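import Mathlib
import Summits.RiemannHypothesis.RiemannHypothesis.Theorems.SignConeConeMagnificationDesignProfiles
import Summits.RiemannHypothesis.RiemannHypothesis.Theorems.SignConeConeMagnificationDesignClasses

/-!
# Crux `SignCone.ConeMagnification` (stmt-RiemannHypothesis-16303), line `Sketch` r8, stub `stub_designOfTypes`:
# Step 1 — the touching mass is bounded (`C₁(P_Q) ≥ 6 C₁ − 5/2`)

Seat-0 programme for the open core `stub_designOfTypes` (design algebra §2, Step 1).  For every finite set `Q` of
primes, the first-order product design with EQUAL ratios `ρ_q = 6/5` at every `q ∈ Q` has normalised profile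
`(6/5)^{#{q ∈ Q : q ∣ n}} = 1 + W(n)`, `W ≥ 1/5` on the `Q`-touching integers and `W(q^k) = 1/5` EXACTLY at prime
powers; since the negative part of `d = c − Λ` lives on prime powers, the type inequality `C₁ + Σ'_{touch} (d/n) W ≤ ½`
gives

  `touch_tsum_le`:   `Σ'_{n touching Q} (c(n) − Λ(n))/n ≤ 5 (½ − C₁)`,

uniformly in `Q` — i.e. the coprime class constant `C₁(P_Q) = C₁ − Σ'_{touch}` is `≥ 6 C₁ − 5/2`.  (Unequal ratios
would leak `Σ_q (ρ_q − ρ_min) log q/q`; this is why the design is built prime by prime with the IVT.)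
-/

noncomputable section

-- `Summit.RiemannHypothesis.RiemannHypothesis.…` repeats a namespace component by design (D-0017 layout).
set_option linter.dupNamespace false

open Finset Filter
open scoped BigOperators ComplexConjugate Topology

namespace Summit.RiemannHypothesis.RiemannHypothesis.Theorems.SignConeConeMagnification

namespace Design

/-! ### Small arithmetic facts -/

/-- The ratio `6/5` is admissible for every prime: `1 − (√p+1)/2 ≤ 6/5 ≤ 1 + (√p−1)/2`. [folklore] -/
theorem six_fifths_admissible (p : ℕ) (hp : p.Prime) :
    1 - (Real.sqrt p + 1) / 2 ≤ (6 / 5 : ℝ) ∧ (6 / 5 : ℝ) ≤ 1 + (Real.sqrt p - 1) / 2 := by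
  constructor
  · have : 0 ≤ Real.sqrt p := Real.sqrt_nonneg _
    linarith
  · have h2 : (7 / 5 : ℝ) ≤ Real.sqrt p := by
      rw [show (7 / 5 : ℝ) = Real.sqrt ((7 / 5) ^ 2) by rw [Real.sqrt_sq]; norm_num]
      apply Real.sqrt_le_sqrt
      have : (2 : ℝ) ≤ p := by exact_mod_cast hp.two_le
      nlinarith
    linarith

/-- No prime of `Q` divides an integer `n ≥ 1` that does not touch `Q`; in particular the filter is empty. [folklore] -/
theorem filter_dvd_eq_empty {Q : Finset ℕ} {n : ℕ} (h : ¬ ∃ q ∈ Q, q ∣ n) : Q.filter (· ∣ n) = ∅ := by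
  rw [Finset.filter_eq_empty_iff]
  exact fun q hq hqn => h ⟨q, hq, hqn⟩

/-- No prime divides `1`. [folklore] -/
theorem not_exists_prime_dvd_one {Q : Finset ℕ} (hQ : ∀ q ∈ Q, q.Prime) : ¬ ∃ q ∈ Q, q ∣ 1 :=
  fun ⟨q, hq, hq1⟩ => (hQ q hq).one_lt.ne' (Nat.dvd_one.1 hq1)

/-- If two distinct primes divide `n` then `Λ(n) = 0`. [folklore] -/
theorem vonMangoldt_eq_zero_of_two_primes {q₁ q₂ n : ℕ} (h1 : q₁.Prime) (h2 : q₂.Prime) (hne : q₁ ≠ q₂)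
    (hd1 : q₁ ∣ n) (hd2 : q₂ ∣ n) : ArithmeticFunction.vonMangoldt n = 0 := by
  rw [ArithmeticFunction.vonMangoldt_eq_zero_iff]
  rintro ⟨r, e, hr, he, rfl⟩
  have hr' : r.Prime := Nat.prime_iff.2 hr
  have e1 : q₁ = r := (Nat.prime_dvd_prime_iff_eq h1 hr').1 (h1.dvd_of_dvd_pow hd1)
  have e2 : q₂ = r := (Nat.prime_dvd_prime_iff_eq h2 hr').1 (h2.dvd_of_dvd_pow hd2)
  exact hne (e1.trans e2.symm)

/-- If at least two primes of `Q` divide `n` then `Λ(n) = 0`. [folklore] -/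
theorem vonMangoldt_eq_zero_of_two_le_card {Q : Finset ℕ} (hQ : ∀ q ∈ Q, q.Prime) {n : ℕ}
    (h : 2 ≤ (Q.filter (· ∣ n)).card) : ArithmeticFunction.vonMangoldt n = 0 := by
  obtain ⟨q₁, q₂, hq₁, hq₂, hne⟩ := Finset.one_lt_card_iff.1 (by omega : 1 < (Q.filter (· ∣ n)).card)
  rw [Finset.mem_filter] at hq₁ hq₂
  exact vonMangoldt_eq_zero_of_two_primes (hQ q₁ hq₁.1) (hQ q₂ hq₂.1) hne hq₁.2 hq₂.2

/-- A touching integer on which `d = c − Λ` is negative is touched exactly once. [folklore] -/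
theorem card_filter_dvd_eq_one_of_neg {Q : Finset ℕ} (hQ : ∀ q ∈ Q, q.Prime) (c : ℕ → ℝ) (hc0 : ∀ n, 0 ≤ c n)
    {n : ℕ} (ht : ∃ q ∈ Q, q ∣ n) (hneg : c n - ArithmeticFunction.vonMangoldt n < 0) :
    (Q.filter (· ∣ n)).card = 1 := by
  have hpos : 0 < (Q.filter (· ∣ n)).card := by
    obtain ⟨q, hq, hqn⟩ := ht
    exact Finset.card_pos.2 ⟨q, Finset.mem_filter.2 ⟨hq, hqn⟩⟩
  by_contra hne
  have h2 : 2 ≤ (Q.filter (· ∣ n)).card := by omega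
  have := vonMangoldt_eq_zero_of_two_le_card hQ h2
  have := hc0 n
  linarith

/-! ### Step 1 -/

/-- **Step 1: the touching mass is bounded** (seat-0, design algebra §2).  Under Loc and TI, for every finite set `Q`
of primes, `Σ'_{n : some q ∈ Q divides n} (c(n) − Λ(n))/n ≤ 5 (½ − C₁)`, where `C₁` is the limit of the partial sums
of `(c(n) − Λ(n))/n`. [folklore] -/
theorem touch_tsum_le (c : ℕ → ℝ) (hc0 : ∀ n, 0 ≤ c n)
    (hLoc : ∀ p : ℕ, p.Prime → Summable (fun n : ℕ => if p ∣ n then c n / n else 0))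
    (hTI : ∀ α : ℕ → ℂ, ∀ L : ℕ, (∀ m, L < m → α m = 0) →
      ∃ T : ℝ, Tendsto (fun x : ℝ => ∑ n ∈ Finset.Icc 1 ⌊x⌋₊,
          (c n - ArithmeticFunction.vonMangoldt n) / n *
            (∑ ℓ ∈ Finset.Icc 1 L, ∑ ℓ' ∈ Finset.Icc 1 L, α ℓ * (starRingEnd ℂ) (α ℓ') *
            (((Nat.gcd (n * ℓ') ℓ : ℕ) : ℝ) : ℂ) / (Real.sqrt ((ℓ : ℝ) * ℓ') : ℂ)).re) atTop (𝓝 T) ∧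
        T ≤ 1 / 2 * (∑ ℓ ∈ Finset.Icc 1 L, ∑ ℓ' ∈ Finset.Icc 1 L, α ℓ * (starRingEnd ℂ) (α ℓ') *
            (((Nat.gcd (1 * ℓ') ℓ : ℕ) : ℝ) : ℂ) / (Real.sqrt ((ℓ : ℝ) * ℓ') : ℂ)).re)
    (C₁ : ℝ) (hC₁ : Tendsto (fun x : ℝ => ∑ n ∈ Finset.Icc 1 ⌊x⌋₊,
        (c n - ArithmeticFunction.vonMangoldt n) / n) atTop (𝓝 C₁))
    (Q : Finset ℕ) (hQ : ∀ q ∈ Q, q.Prime) :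
    Summable (fun n : ℕ => if (∃ q ∈ Q, q ∣ n) then (c n - ArithmeticFunction.vonMangoldt n) / n else 0) ∧
    ∑' n : ℕ, (if (∃ q ∈ Q, q ∣ n) then (c n - ArithmeticFunction.vonMangoldt n) / n else 0) ≤
      5 * (1 / 2 - C₁) := by
  classical
  -- the equal-ratio design and its TI limit
  obtain ⟨α, L, K, hK, hsupp, hprof⟩ := gcdForm_firstOrderDesign Q hQ (fun _ => 6 / 5)
    (fun p hp => six_fifths_admissible p (hQ p hp))
  set Z : ℕ → ℂ := fun n => (((6 / 5 : ℝ) ^ (Q.filter (· ∣ n)).card : ℝ) : ℂ) with hZdef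
  have hZ : ∀ n : ℕ, n ≠ 0 → (∑ ℓ ∈ Finset.Icc 1 L, ∑ ℓ' ∈ Finset.Icc 1 L, α ℓ * (starRingEnd ℂ) (α ℓ') *
      (((Nat.gcd (n * ℓ') ℓ : ℕ) : ℝ) : ℂ) / (Real.sqrt ((ℓ : ℝ) * ℓ') : ℂ)) = (K : ℂ) * Z n := by
    intro n hn
    rw [hprof n hn, hZdef, Finset.prod_const]
    push_cast
    ring
  obtain ⟨T, hT, hTle⟩ := tendsto_TI_profile c hTI α L K hK hsupp Z hZ
  have hZre : ∀ n, (Z n).re = (6 / 5 : ℝ) ^ (Q.filter (· ∣ n)).card := fun n => by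
    simp only [hZdef, Complex.ofReal_re]
  simp_rw [hZre] at hT hTle
  rw [filter_dvd_eq_empty (not_exists_prime_dvd_one hQ), Finset.card_empty, pow_zero, mul_one] at hTle
  -- decomposition along the touching integers
  have hψ : ∀ n : ℕ, n ≠ 0 → (¬ ∃ q ∈ Q, q ∣ n) → (6 / 5 : ℝ) ^ (Q.filter (· ∣ n)).card = 1 := by
    intro n _ h
    rw [filter_dvd_eq_empty h, Finset.card_empty, pow_zero]
  have hB : ∀ n : ℕ, |(6 / 5 : ℝ) ^ (Q.filter (· ∣ n)).card| ≤ (6 / 5 : ℝ) ^ Q.card := by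
    intro n
    rw [abs_of_nonneg (by positivity)]
    exact pow_le_pow_right₀ (by norm_num) (Finset.card_filter_le _ _)
  obtain ⟨hgs, hTeq⟩ := TI_touch_decomposition c hc0 hLoc Q hQ (fun n => (6 / 5 : ℝ) ^ (Q.filter (· ∣ n)).card)
    1 _ hψ hB C₁ hC₁ T hT
  -- the touching sum itself
  have hts : Summable (fun n : ℕ => if (∃ q ∈ Q, q ∣ n) then
      (c n - ArithmeticFunction.vonMangoldt n) / n else 0) := by
    refine Summable.of_norm (( summable_touch_abs_dwt_div c hc0 hLoc Q hQ).congr fun n => ?_)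
    split_ifs
    · rw [Real.norm_eq_abs, abs_div, Nat.abs_cast]
    · simp
  refine ⟨hts, ?_⟩
  -- pointwise: `g ≥ (1/5) · touch`
  have hpt : ∀ n : ℕ, (1 / 5 : ℝ) * (if (∃ q ∈ Q, q ∣ n) then
      (c n - ArithmeticFunction.vonMangoldt n) / n else 0) ≤
      (if (∃ q ∈ Q, q ∣ n) then (c n - ArithmeticFunction.vonMangoldt n) / n *
        ((6 / 5 : ℝ) ^ (Q.filter (· ∣ n)).card - 1) else 0) := by
    intro n
    split_ifs with ht
    · have hk : 1 ≤ (Q.filter (· ∣ n)).card := by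
        obtain ⟨q, hq, hqn⟩ := ht
        exact Finset.card_pos.2 ⟨q, Finset.mem_filter.2 ⟨hq, hqn⟩⟩
      rcases lt_or_ge (c n - ArithmeticFunction.vonMangoldt n) 0 with hneg | hnn
      · -- negative: a prime power, touched exactly once
        rw [card_filter_dvd_eq_one_of_neg hQ c hc0 ht hneg]
        norm_num
        exact le_of_eq (by ring)
      · have hdn : 0 ≤ (c n - ArithmeticFunction.vonMangoldt n) / n := div_nonneg hnn (Nat.cast_nonneg _)
        have hW : (1 / 5 : ℝ) ≤ (6 / 5 : ℝ) ^ (Q.filter (· ∣ n)).card - 1 := by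
          have : (6 / 5 : ℝ) ^ 1 ≤ (6 / 5 : ℝ) ^ (Q.filter (· ∣ n)).card :=
            pow_le_pow_right₀ (by norm_num) hk
          linarith
        nlinarith
    · simp
  have hcmp := (hts.mul_left (1 / 5)).tsum_le_tsum hpt hgs
  rw [tsum_mul_left] at hcmp
  linarith

/-- **Registered sub-goal `designTouchBound`** (seat-0 anchor of this file, design algebra §2 Step 1 of the proof of
`stub_designOfTypes`): under Loc and TI the touching mass `Σ'_{n touching Q} (c(n) − Λ(n))/n` is `≤ 5(½ − C₁)` for every
finite set `Q` of primes. [folklore] -/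
theorem designTouchBound : ∀ c : ℕ → ℝ, (∀ n, 0 ≤ c n) →
    (∀ p : ℕ, p.Prime → Summable (fun n : ℕ => if p ∣ n then c n / n else 0)) →
    (∀ α : ℕ → ℂ, ∀ L : ℕ, (∀ m, L < m → α m = 0) →
      ∃ T : ℝ, Filter.Tendsto (fun x : ℝ => ∑ n ∈ Finset.Icc 1 ⌊x⌋₊,
          (c n - ArithmeticFunction.vonMangoldt n) / n *
            (∑ ℓ ∈ Finset.Icc 1 L, ∑ ℓ' ∈ Finset.Icc 1 L, α ℓ * (starRingEnd ℂ) (α ℓ') *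
            (((Nat.gcd (n * ℓ') ℓ : ℕ) : ℝ) : ℂ) / (Real.sqrt ((ℓ : ℝ) * ℓ') : ℂ)).re) Filter.atTop (nhds T) ∧
        T ≤ 1 / 2 * (∑ ℓ ∈ Finset.Icc 1 L, ∑ ℓ' ∈ Finset.Icc 1 L, α ℓ * (starRingEnd ℂ) (α ℓ') *
            (((Nat.gcd (1 * ℓ') ℓ : ℕ) : ℝ) : ℂ) / (Real.sqrt ((ℓ : ℝ) * ℓ') : ℂ)).re) →
    ∀ C₁ : ℝ, Filter.Tendsto (fun x : ℝ => ∑ n ∈ Finset.Icc 1 ⌊x⌋₊,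
        (c n - ArithmeticFunction.vonMangoldt n) / n) Filter.atTop (nhds C₁) →
    ∀ Q : Finset ℕ, (∀ q ∈ Q, q.Prime) →
    Summable (fun n : ℕ => if (∃ q ∈ Q, q ∣ n) then (c n - ArithmeticFunction.vonMangoldt n) / n else 0) ∧
    ∑' n : ℕ, (if (∃ q ∈ Q, q ∣ n) then (c n - ArithmeticFunction.vonMangoldt n) / n else 0) ≤
      5 * (1 / 2 - C₁) :=
  fun c hc0 hLoc hTI C₁ hC₁ Q hQ => touch_tsum_le c hc0 hLoc hTI C₁ hC₁ Q hQ

end Design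

end Summit.RiemannHypothesis.RiemannHypothesis.Theorems.SignConeConeMagnification
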